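import Literature.NumberTheory.GelbartRogawski1991.PiSCompletionIsThetaTypeTestSignTransport   -- ★ p848379 (this seat): (D-b) transport; brings ★ p848284 `CharIdentityOnTestFunctionsSignTransport` (B1)
import Literature.NumberTheory.Automorphic.LocalHermitianFormSign                            -- ★ p848301 LH7-p01 (g0): `formSignAt`, `intCast_ite_isUnitNorm_eq_formSignAt_of_formCongr_eq_smul`, `formSignAt_of_not_subsingleton`
import Literature.NumberTheory.Automorphic.LocalUnitaryGroupCongrInner                        -- ★ `conjLocal_eq_self_of_formCongr_eq_smul_antidiag`
import Literature.NumberTheory.Automorphic.UnitaryGroupSplitPlace                             -- ★ `PlacesOver.galInv_ne` (two places above a split `v`)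
import HarnessLib

/-!
# The sign transport CLOSED at the form sign: the unsigned letters at `Δ° := v ↦ (Δ v).constMul ↑(formSignAt L c H v)` ARE the signed letters at `Δ`
(Rogawski (1990) §4.9 p. 55, §13.1 Prop. 13.1.4 p. 199, §14.6 p. 242; Gelbart–Rogawski (1991) Lem. 5.1.2 p. 466; Langlands–Shelstad (1987) §1)

Topic `NumberTheory/Rogawski1990`; namespace `Literature.NumberTheory.Rogawski1990`.  THEOREMS ONLY (no definition, no instance, no notation, no named fact, no
`sorry`).  Cell `pub/hodgecm-mathlib` (D-0151), crux H413 = `stmt-HodgeConjecture-24833`; item (B1′) «CLOSED SIGN FAMILY» of F0P2-ref1 (g10) r358 (3); seat F0P2-p06 (g14).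
HONEST LABEL: HC_CM is proved only modulo the printed citations (2 remaining named inputs hLiu418, h413) until rung 0 closes; this file proves no printed statement — it plugs
LH7's form sign ★ `formSignAt` (p848301) into the sign-generic transports of ★ `CharIdentityOnTestFunctionsSignTransport` (p848284) and ★ `PiSCompletionIsThetaTypeTestSignTransport`
(p848379), discharging their two hypotheses `hεn` (the clause sign of EVERY frame equals `ε v` at non-split `v`) and `hεs` (`ε v = 1` at split `v`) once and for all.

THE TWO DISCHARGES.  (n) At a non-split `v` (one place above `v`, ★ `PlacesOver.subsingleton_of_smul_eq`) and any frame `ᵗσT · H_v · T = a · Φ₃` with `H` hermitian, the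
multiplier `a` is `σ`-fixed (★ `conjLocal_eq_self_of_formCongr_eq_smul_antidiag`) and LH7's bridge ★ `intCast_ite_isUnitNorm_eq_formSignAt_of_formCongr_eq_smul` («`a ≡ −det H`
modulo norms») gives `(if ∃ z, IsUnit z ∧ a = z·σz then 1 else −1 : ℂ) = ↑(formSignAt L c H v)`.  (s) At a split `v` there are two places above `v` (★ `PlacesOver.galInv_ne`),
so ★ `formSignAt_of_not_subsingleton` gives `formSignAt L c H v = 1`.

* §1 `intCast_formSignAt_ne_zero`, `intCast_formSignAt_mul_self`; **`clauseSign_eq_intCast_formSignAt`** ((n), the `hεn` discharge), **`intCast_formSignAt_eq_one_of_split`** ((s), `hεs`).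
* §2 at `Δ° := fun v => (Δ v).constMul ((formSignAt L (IsCMField.complexConj L) H v : ℤ) : ℂ)`: **`isLocalDeltaTransferExists_constMul_formSignAt_iff`** ((H₇)),
  **`cmCharIdentityClausesTest_constMul_formSignAt_iff_signed`**, **`cmCharIdentityPackageTest_constMul_formSignAt_iff_signed`** ((Qᵀ) at `Δ°` ↔ (Qᵀˢ) at `Δ`),
  **`piSCompletion_isThetaTypeAtCMTest_constMul_formSignAt_iff_signed`** ((D-b)ᵀ at `Δ°` ↔ (D-b)ᵀˢ at `Δ`) — hypothesis-free in the sign.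

## References
* [Rogawski1990] J. D. Rogawski, *Automorphic Representations of Unitary Groups in Three Variables*, Ann. of Math. Stud. 123 (1990): §4.9 Prop. 4.9.1 (a) p. 55; §13.1
  Prop. 13.1.3 (d), Prop. 13.1.4 p. 199; §13.3 p. 202; §14.6 p. 242.
* [GelbartRogawski1991] S. Gelbart, J. Rogawski, Invent. Math. 105 (1991): Lem. 5.1.2 p. 466; Thm. 5.1.1 p. 465.
* [LanglandsShelstad1987] R. P. Langlands, D. Shelstad, Math. Ann. 278 (1987): §1.
-/

set_option autoImplicit false

noncomputable section

open MeasureTheory NumberField IsDedekindDomain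
open scoped Matrix ComplexOrder

namespace Literature.NumberTheory.Rogawski1990

open Literature.NumberTheory Literature.NumberTheory.Automorphic Literature.NumberTheory.Automorphic.UnitaryGroup
open Literature.NumberTheory.GaloisRepresentations Literature.NumberTheory.GelbartRogawski1991

/-! ## §1 The two discharges: the clause sign of every non-split frame is the form sign; the form sign is `1` at split places -/

section Sign

variable (L : Type) [Field L] [NumberField L] [IsCMField L] (H : Matrix (Fin 3) (Fin 3) L)

/-- `↑(formSignAt L c H v) ≠ 0` in `ℂ` (it is `±1`). [cite: Rogawski1990, §14.6 p. 242] -/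
theorem intCast_formSignAt_ne_zero (v : HeightOneSpectrum (𝓞 ↥(maximalRealSubfield L))) :
    ((formSignAt L (IsCMField.complexConj L) H v : ℤ) : ℂ) ≠ 0 := by
  rcases formSignAt_eq_one_or_eq_neg_one L (IsCMField.complexConj L) H v with h | h <;> rw [h] <;> norm_num

/-- `↑(formSignAt L c H v) · ↑(formSignAt L c H v) = 1` in `ℂ`. [cite: Rogawski1990, §14.6 p. 242] -/
theorem intCast_formSignAt_mul_self (v : HeightOneSpectrum (𝓞 ↥(maximalRealSubfield L))) :
    ((formSignAt L (IsCMField.complexConj L) H v : ℤ) : ℂ) * ((formSignAt L (IsCMField.complexConj L) H v : ℤ) : ℂ) = 1 := by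
  rw [← Int.cast_mul, formSignAt_mul_self, Int.cast_one]

open scoped Classical in
/-- **THE CLAUSE SIGN OF EVERY FRAME IS THE FORM SIGN (non-split `v`, `H` hermitian)** — the `hεn` hypothesis of ★ `cmCharIdentityClausesTest_constMul_iff_signed` ∕
★ `piSCompletion_isThetaTypeAtCMTest_constMul_iff_signed` at `ε := ↑(formSignAt L c H ·)`: for `ᵗσT · H_v · T = a · Φ₃`,
`(if ∃ z, IsUnit z ∧ a = z · σ z then 1 else −1 : ℂ) = ↑(formSignAt L c H v)` (LH7's bridge «`a ≡ −det H` modulo norms», with the multiplier's `σ`-fixedness from `H`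
hermitian and one place above `v`). [cite: Rogawski1990, §14.6 p. 242; §3.5 Prop. 3.5.2 (c) p. 29] [cite: LanglandsShelstad1987, §1] -/
theorem clauseSign_eq_intCast_formSignAt (hH : (H.map (cmConjRingHom L))ᵀ = H) (v : HeightOneSpectrum (𝓞 ↥(maximalRealSubfield L)))
    (hns : ∀ w : PlacesOver L v, IsCMField.complexConj L • w.1 = w.1) (T : GL (Fin 3) (LocalRing L v)) (a : LocalRing L v) (ha : IsUnit a)
    (h : formCongr (conjLocal L (IsCMField.complexConj L) v) T (H.map (algebraMap L (LocalRing L v))) =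
      a • (Matrix.of fun i j : Fin 3 => if i.val + j.val + 1 = 3 then (1 : L) else 0).map (algebraMap L (LocalRing L v))) :
    (if ∃ z : LocalRing L v, IsUnit z ∧ a = z * conjLocal L (IsCMField.complexConj L) v z then (1 : ℂ) else -1) =
      ((formSignAt L (IsCMField.complexConj L) H v : ℤ) : ℂ) := by
  obtain ⟨w⟩ := (inferInstance : Nonempty (PlacesOver L v))
  have hv : Subsingleton (PlacesOver L v) :=
    PlacesOver.subsingleton_of_smul_eq (IsCMField.complexConj L) (IsCMField.complexConj_ne_one L) w (hns w)
  have hσa : conjLocal L (IsCMField.complexConj L) v a = a := conjLocal_eq_self_of_formCongr_eq_smul_antidiag L (by norm_num) hH v T h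
  exact intCast_ite_isUnitNorm_eq_formSignAt_of_formCongr_eq_smul L (IsCMField.complexConj L) H v hv ha hσa h

/-- **AT A SPLIT PLACE THE FORM SIGN IS `1`** — the `hεs` hypothesis of ★ `cmCharIdentityClausesTest_constMul_iff_signed` at `ε := ↑(formSignAt L c H ·)`: two places above `v`
(★ `PlacesOver.galInv_ne`), so ★ `formSignAt_of_not_subsingleton`. [cite: Rogawski1990, §14.6 p. 242] -/
theorem intCast_formSignAt_eq_one_of_split (v : HeightOneSpectrum (𝓞 ↥(maximalRealSubfield L)))
    (hs : ∃ w : PlacesOver L v, IsCMField.complexConj L • w.1 ≠ w.1) :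
    ((formSignAt L (IsCMField.complexConj L) H v : ℤ) : ℂ) = 1 := by
  obtain ⟨w, hw⟩ := hs
  have hv : ¬ Subsingleton (PlacesOver L v) := fun _ =>
    PlacesOver.galInv_ne (IsCMField.complexConj L) w hw (Subsingleton.elim _ _)
  rw [formSignAt_of_not_subsingleton L (IsCMField.complexConj L) H v hv, Int.cast_one]

end Sign

/-! ## §2 The transports at `Δ° := fun v => (Δ v).constMul ↑(formSignAt L c H v)`, hypothesis-free in the sign -/

section TransferExists

variable (L : Type) [Field L] [NumberField L] [IsCMField L] (H : Matrix (Fin 3) (Fin 3) L)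
  (v : HeightOneSpectrum (𝓞 ↥(maximalRealSubfield L)))
  {iH : ∀ a : ((UnitaryGroup.cmDatum L 2 (Matrix.of fun i j : Fin 2 => if i.val + j.val + 1 = 2 then (1 : L) else 0)).Local v ×
      (UnitaryGroup.cmDatum L 1 (Matrix.of fun i j : Fin 1 => if i.val + j.val + 1 = 1 then (1 : L) else 0)).Local v),
    MeasurableSpace (((UnitaryGroup.cmDatum L 2 (Matrix.of fun i j : Fin 2 => if i.val + j.val + 1 = 2 then (1 : L) else 0)).Local v ×
      (UnitaryGroup.cmDatum L 1 (Matrix.of fun i j : Fin 1 => if i.val + j.val + 1 = 1 then (1 : L) else 0)).Local v) ⧸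
      Subgroup.centralizer ({a} : Set ((UnitaryGroup.cmDatum L 2 (Matrix.of fun i j : Fin 2 => if i.val + j.val + 1 = 2 then (1 : L) else 0)).Local v ×
      (UnitaryGroup.cmDatum L 1 (Matrix.of fun i j : Fin 1 => if i.val + j.val + 1 = 1 then (1 : L) else 0)).Local v)))}
  {iG : ∀ γ : (UnitaryGroup.cmDatum L 3 H).Local v,
    MeasurableSpace ((UnitaryGroup.cmDatum L 3 H).Local v ⧸ Subgroup.centralizer ({γ} : Set ((UnitaryGroup.cmDatum L 3 H).Local v)))}

/-- **(H₇) at `Δ°_v` ⟺ (H₇) at `Δ_v`** (★ `isLocalDeltaTransferExists_constMul_iff` at `↑(formSignAt …) ≠ 0`). [cite: Rogawski1990, §4.9 Prop. 4.9.1 (a) p. 55; §14.6 p. 242] -/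
theorem isLocalDeltaTransferExists_constMul_formSignAt_iff (T : LocalTransferFactor L H v)
    (mH : OrbitalMeasureFamily ((UnitaryGroup.cmDatum L 2 (Matrix.of fun i j : Fin 2 => if i.val + j.val + 1 = 2 then (1 : L) else 0)).Local v ×
        (UnitaryGroup.cmDatum L 1 (Matrix.of fun i j : Fin 1 => if i.val + j.val + 1 = 1 then (1 : L) else 0)).Local v))
    (mG : OrbitalMeasureFamily ((UnitaryGroup.cmDatum L 3 H).Local v)) :
    IsLocalDeltaTransferExists L H v (_ha := iH) (_hγ := iG) (T.constMul ((formSignAt L (IsCMField.complexConj L) H v : ℤ) : ℂ)) mH mG IsLocSmooth IsLocSmooth ↔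
      IsLocalDeltaTransferExists L H v (_ha := iH) (_hγ := iG) T mH mG IsLocSmooth IsLocSmooth :=
  isLocalDeltaTransferExists_constMul_iff L H v T mH mG (intCast_formSignAt_ne_zero L H v)

end TransferExists

section Transport

variable (L : Type) [Field L] [NumberField L] [IsCMField L] (H : Matrix (Fin 3) (Fin 3) L)
  (hH : (H.map (cmConjRingHom L))ᵀ = H) (hHd : IsUnit H.det)

variable
    [∀ v : HeightOneSpectrum (𝓞 ↥(maximalRealSubfield L)), MeasurableSpace ((cmDatum L 3 H).Local v)]
    [∀ v : HeightOneSpectrum (𝓞 ↥(maximalRealSubfield L)),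
      MeasurableSpace ((cmDatum L 2 (Matrix.of fun i j : Fin 2 => if i.val + j.val + 1 = 2 then (1 : L) else 0)).Local v ×
        (cmDatum L 1 (Matrix.of fun i j : Fin 1 => if i.val + j.val + 1 = 1 then (1 : L) else 0)).Local v)]
    [∀ (v : HeightOneSpectrum (𝓞 ↥(maximalRealSubfield L)))
        (a : ((cmDatum L 2 (Matrix.of fun i j : Fin 2 => if i.val + j.val + 1 = 2 then (1 : L) else 0)).Local v ×
          (cmDatum L 1 (Matrix.of fun i j : Fin 1 => if i.val + j.val + 1 = 1 then (1 : L) else 0)).Local v)),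
      MeasurableSpace (((cmDatum L 2 (Matrix.of fun i j : Fin 2 => if i.val + j.val + 1 = 2 then (1 : L) else 0)).Local v ×
          (cmDatum L 1 (Matrix.of fun i j : Fin 1 => if i.val + j.val + 1 = 1 then (1 : L) else 0)).Local v) ⧸
        Subgroup.centralizer ({a} : Set ((cmDatum L 2 (Matrix.of fun i j : Fin 2 => if i.val + j.val + 1 = 2 then (1 : L) else 0)).Local v ×
          (cmDatum L 1 (Matrix.of fun i j : Fin 1 => if i.val + j.val + 1 = 1 then (1 : L) else 0)).Local v)))]
    [∀ (v : HeightOneSpectrum (𝓞 ↥(maximalRealSubfield L))) (γ : (cmDatum L 3 H).Local v),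
      MeasurableSpace ((cmDatum L 3 H).Local v ⧸ Subgroup.centralizer ({γ} : Set ((cmDatum L 3 H).Local v)))]

variable
  (Δ : ∀ v : HeightOneSpectrum (𝓞 ↥(maximalRealSubfield L)), LocalTransferFactor L H v)
  (mH : ∀ v : HeightOneSpectrum (𝓞 ↥(maximalRealSubfield L)),
    OrbitalMeasureFamily ((cmDatum L 2 (Matrix.of fun i j : Fin 2 => if i.val + j.val + 1 = 2 then (1 : L) else 0)).Local v ×
      (cmDatum L 1 (Matrix.of fun i j : Fin 1 => if i.val + j.val + 1 = 1 then (1 : L) else 0)).Local v))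
  (mG : ∀ v : HeightOneSpectrum (𝓞 ↥(maximalRealSubfield L)), OrbitalMeasureFamily ((cmDatum L 3 H).Local v))
  (νH : ∀ v : HeightOneSpectrum (𝓞 ↥(maximalRealSubfield L)),
    Measure ((cmDatum L 2 (Matrix.of fun i j : Fin 2 => if i.val + j.val + 1 = 2 then (1 : L) else 0)).Local v ×
      (cmDatum L 1 (Matrix.of fun i j : Fin 1 => if i.val + j.val + 1 = 1 then (1 : L) else 0)).Local v))
  (νG : ∀ v : HeightOneSpectrum (𝓞 ↥(maximalRealSubfield L)), Measure ((cmDatum L 3 H).Local v))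
  (μω : HeckeCharacter L) (hμu : μω.IsUnitary)

/-- **THE UNSIGNED CLAUSES AT `Δ°` ARE THE SIGNED CLAUSES AT `Δ`** (★ `cmCharIdentityClausesTest_constMul_iff_signed` with §1's two discharges).
[cite: Rogawski1990, §13.1 Prop. 13.1.3 (d), Prop. 13.1.4 p. 199; §14.6 p. 242; §13.3 p. 201] [cite: LanglandsShelstad1987, §1] -/
theorem cmCharIdentityClausesTest_constMul_formSignAt_iff_signed (ξ : OneDimAutRepH L)
    (ξloc : ∀ v : HeightOneSpectrum (𝓞 ↥(maximalRealSubfield L)),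
      (cmDatum L 2 (Matrix.of fun i j : Fin 2 => if i.val + j.val + 1 = 2 then (1 : L) else 0)).Local v ×
        (cmDatum L 1 (Matrix.of fun i j : Fin 1 => if i.val + j.val + 1 = 1 then (1 : L) else 0)).Local v →* ℂˣ) :
    CMCharIdentityClausesTest L H hH hHd (fun v => (Δ v).constMul ((formSignAt L (IsCMField.complexConj L) H v : ℤ) : ℂ)) mH mG νH νG ξ μω hμu ξloc ↔
      CMCharIdentityClausesTestSigned L H hH hHd Δ mH mG νH νG ξ μω hμu ξloc :=
  cmCharIdentityClausesTest_constMul_iff_signed L H hH hHd Δ mH mG νH νG μω hμu ξ ξloc (fun v => ((formSignAt L (IsCMField.complexConj L) H v : ℤ) : ℂ))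
    (fun v hns T a ha h => clauseSign_eq_intCast_formSignAt L H hH v hns T a ha h) (fun v hs => intCast_formSignAt_eq_one_of_split L H v hs)

/-- **THE UNSIGNED PACKAGE `Q_CM^{test}` AT `Δ°` IS THE SIGNED PACKAGE `Q_CM^{test,±}` AT `Δ`** (★ `cmCharIdentityPackageTest_constMul_iff_signed` with §1's two discharges) —
the (Qᵀ) currency at print's factor from the closer's `hQS` at the factor of record. [cite: Rogawski1990, §13.1 Prop. 13.1.4 p. 199; §13.3 p. 202; §14.6 p. 242]
[cite: LanglandsShelstad1987, §1] -/
theorem cmCharIdentityPackageTest_constMul_formSignAt_iff_signed :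
    CMCharIdentityPackageTest L H hH hHd νH νG μω hμu (fun v => (Δ v).constMul ((formSignAt L (IsCMField.complexConj L) H v : ℤ) : ℂ)) mH mG ↔
      CMCharIdentityPackageTestSigned L H hH hHd νH νG μω hμu Δ mH mG :=
  cmCharIdentityPackageTest_constMul_iff_signed L H hH hHd Δ mH mG νH νG μω hμu (fun v => ((formSignAt L (IsCMField.complexConj L) H v : ℤ) : ℂ))
    (fun v hns T a ha h => clauseSign_eq_intCast_formSignAt L H hH v hns T a ha h) (fun v hs => intCast_formSignAt_eq_one_of_split L H v hs)

include hH in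
/-- **(D-b)ᵀ AT `Δ°` ⟺ (D-b)ᵀˢ AT `Δ`** (★ `piSCompletion_isThetaTypeAtCMTest_constMul_iff_signed` with §1 (n)). [cite: GelbartRogawski1991, Lem. 5.1.2 p. 466; Thm. 5.1.1 p. 465]
[cite: Rogawski1990, §13.1 Prop. 13.1.4 p. 199; §14.6 p. 242] -/
theorem piSCompletion_isThetaTypeAtCMTest_constMul_formSignAt_iff_signed (ξ : OneDimAutRepH L)
    (ξloc : ∀ v : HeightOneSpectrum (𝓞 ↥(maximalRealSubfield L)),
      (cmDatum L 2 (Matrix.of fun i j : Fin 2 => if i.val + j.val + 1 = 2 then (1 : L) else 0)).Local v ×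
        (cmDatum L 1 (Matrix.of fun i j : Fin 1 => if i.val + j.val + 1 = 1 then (1 : L) else 0)).Local v →* ℂˣ)
    {n' : ℕ} (e₁ : Fin 3 × Fin 1 ≃ Fin n') (dV : Fin 3 → L) (hdV : ∀ i, IsCMField.complexConj L (dV i) = dV i) (hdV0 : ∀ i, dV i ≠ 0) (g : GL (Fin 3) L)
    (hg : ((g : Matrix (Fin 3) (Fin 3) L).map (cmConjRingHom L))ᵀ * H * (g : Matrix (Fin 3) (Fin 3) L) = Matrix.diagonal dV) :
    piSCompletion_isThetaTypeAtCMTest L H (fun v => (Δ v).constMul ((formSignAt L (IsCMField.complexConj L) H v : ℤ) : ℂ)) mH mG νH νG ξ μω ξloc e₁ dV hdV hdV0 g hg ↔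
      piSCompletion_isThetaTypeAtCMTestSigned L H Δ mH mG νH νG ξ μω ξloc e₁ dV hdV hdV0 g hg :=
  piSCompletion_isThetaTypeAtCMTest_constMul_iff_signed L H Δ mH mG νH νG ξ μω ξloc e₁ dV hdV hdV0 g hg
    (fun v => ((formSignAt L (IsCMField.complexConj L) H v : ℤ) : ℂ)) (fun v hns T a ha h => clauseSign_eq_intCast_formSignAt L H hH v hns T a ha h)

end Transport

end Literature.NumberTheory.Rogawski1990

end
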